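import Summits.AtomisticToContinuum.FouriersLaw.Theses.CageBudgetFekete
import Summits.AtomisticToContinuum.FouriersLaw.Theorems.CageBudgetFeketeQuasiSuperadditiveHeatVarianceStubWindowDomination
import Summits.AtomisticToContinuum.FouriersLaw.Theorems.CageBudgetFeketeQuasiSuperadditiveHeatVarianceStubWindowBudget

/-!
# Line `Sketch` (idea `return-flow-bernstein`) — crux `QuasiSuperadditiveHeatVariance`
(stmt-AtomisticToContinuum-15769), route CageBudgetFekete — LEAD-OWNED SKELETON, RESHAPE 2 (lead c1)

Crux (route decl `Summit.AtomisticToContinuum.FouriersLaw.Theses.CageBudgetFekete.QuasiSuperadditiveHeatVariance`):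
for `pinnedChain ω₂ lam β γ` (`ω₂, lam, β > 0`), every `T > 0` and every guarded pair `(μ, D)` with absolutely
convergent, continuous summed current autocorrelation `C(t) = D.currentCorrelation μ t`, the heat variance
`V(τ) = 2∫_{(0,τ]} (τ−s) C(s) ds` satisfies `∃ K ≥ 0, ∀ s t ≥ 0, V s + V t ≤ V (s+t) + K`.

## The line: WINDOW DOMINATION + WINDOW BUDGET + NEGATIVE-MEMORY MOMENT (three registered stubs)

Adjacent-window identity (Einstein–Helfand bookkeeping): `V(s+t) − V(s) − V(t) = 2∫₀ˢ (∫ᵤ^{u+t} C(w) dw) du` for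
`s, t ≥ 0`.  Hence, whenever the memory is bounded BELOW by minus a continuous kernel `K`, `C ≥ −K` on `[0,∞)`,
`V(s) + V(t) ≤ V(s+t) + 2∫₀ˢ∫ᵤ^{u+t} K` (stub A1, LANDED p160815).  For a NONNEGATIVE continuous kernel the
sliding-window budget is controlled by the running first moment, `∫₀ˢ∫ᵤ^{u+t} K ≤ ∫_{(0,s+t]} w K(w) dw`
(stub A3, pure real analysis, provable now: with `I = ∫₀K` nondecreasing, `∫₀ˢ (I(u+t) − I(u)) du =
∫ₜ^{s+t} I − ∫₀ˢ I` and `∫_{(0,s+t]} wK = (s+t) I(s+t) − ∫₀^{s+t} I` by parts, so the slack is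
`[s·I(s+t) − ∫ₜ^{s+t} I] + [t·I(s+t) − ∫ₛ^{s+t} I] ≥ 0`).  The OPTIMAL kernel is `K := C⁻ = max(−C, 0)` itself, so the
physical half of the line is exactly the route header's cage budget (TWO-LAYER PLAN node `NegativeMemoryMoment`,
= line `birth`'s stub M verbatim): the running first moment of the negative part of the memory is bounded,
`∃ K₀, ∀ R ≥ 0, ∫_{(0,R]} w·C_T⁻(w) dw ≤ K₀` (stub M, physics, the bet; held by the lead).

RESHAPE 2 (this file; lead prover-line-…-15769-c1-0, 2026-08-17): the previous physics stub P
(`stub_returnFlowDomination`: a completely monotone = Bernstein majorant `∫e^{−λt}dm` of `C_T⁻` with `∫λ⁻²dm < ∞`)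
was STRICTLY STRONGER than M (P ⇔ "the decreasing envelope of `C_T⁻` has finite first moment", by dyadic
enveloping) and bought nothing for it: the composition only ever used the window budget of the majorant.  Replacing
the Bernstein budget (stub A2, LANDED p161181, now auxiliary) by the general window budget A3 lets the physics stub be
the weakest statement this composition supports, M.  Strength ladder (all arrows strict; SKELVET / strategist census):
`P ⇒ M ⇒ F (ratio floor ∫₀^τ sC ≥ −K′) ⇒ Q`.

* `stub_windowDomination` (A1, real analysis, LANDED): continuous `C`, `K`, `−K ≤ C` on `[0,∞)` ⇒
  `V s + V t ≤ V (s+t) + 2 ∫ u in 0..s, ∫ w in u..(u+t), K w`.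
* `stub_windowBudget` (A3, real analysis, LANDED p163077): continuous `K ≥ 0` ⇒ for `s, t ≥ 0`,
  `∫ u in 0..s, ∫ w in u..(u+t), K w ≤ ∫ w in Ioc 0 (s+t), w * K w`.
* `stub_negativeMemoryMoment` (M, physics, the bet): crux arena ⇒
  `∃ K₀, ∀ R ≥ 0, ∫ w in Ioc 0 R, w * max (−C_T w) 0 ≤ K₀`.

Assembly (sorry-free): `QuasiSuperadditiveHeatVariance_of : A1 → A3 → M → Q` BY NAME, `K := 2·max K₀ 0`.

Disproof used: none exists (payload `disproof_path` absent on disk; `ledger crux ls`: no `Disproof.lean`,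
2026-08-17T13:10Z).  Landed negative lemma `…Negative.quasiSuperadditiveHeatVariance_false_without_dynamics`
honoured at M: its witness `4(1+|t|)⁻³ − (1+|t|)⁻²` has `C⁻ ≍ t⁻²`, running first moment `≍ log R → ∞`, so M
correctly fails there.  Why M might fail (route): a negative algebraic tail `−t^(−a)`, `a ≤ 2`, of the summed-current
memory; nothing rigorous controls `C_T` of the deterministic anharmonic chain beyond `t = 0` at any `T > 0`.
-/

namespace Summit.AtomisticToContinuum.FouriersLaw.Cruxes.QuasiSuperadditiveHeatVariance.ReturnFlowBernstein

open MeasureTheory Set Filter Topology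
open Literature.MathematicalPhysics.KineticTheory.HeatConduction

/-- STUB A1 — WINDOW DOMINATION (pure real analysis; every continuous memory).  For continuous `C, K : ℝ → ℝ` with
`−K t ≤ C t` for `t ≥ 0` and `V(τ) = 2∫_{(0,τ]} (τ−s) C(s) ds`: for all `s, t ≥ 0`,
`V s + V t ≤ V (s+t) + 2 ∫₀ˢ (∫ᵤ^{u+t} K) du`.  LANDED (p160815):
`Theorems/CageBudgetFeketeQuasiSuperadditiveHeatVarianceStubWindowDomination.lean`. [cite: Helfand1960] -/
theorem stub_windowDomination :
    ∀ C K : ℝ → ℝ, Continuous C → Continuous K → (∀ t : ℝ, 0 ≤ t → -K t ≤ C t) →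
    ∀ V : ℝ → ℝ, V = (fun τ : ℝ => 2 * ∫ s in Set.Ioc (0:ℝ) τ, (τ - s) * C s) →
    ∀ s t : ℝ, 0 ≤ s → 0 ≤ t →
      V s + V t ≤ V (s + t) + 2 * ∫ u in (0:ℝ)..s, ∫ w in u..(u + t), K w :=
  _root_.Summit.AtomisticToContinuum.FouriersLaw.Theorems.QuasiSuperadditiveHeatVariance.ReturnFlowBernstein.stub_windowDomination

/-- STUB A3 — WINDOW BUDGET OF A NONNEGATIVE KERNEL (pure real analysis; LANDED p163077,
`Theorems/CageBudgetFeketeQuasiSuperadditiveHeatVarianceStubWindowBudget.lean`).  For a continuous kernel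
`K ≥ 0` and `s, t ≥ 0`: `∫₀ˢ (∫ᵤ^{u+t} K(w) dw) du ≤ ∫_{(0,s+t]} w·K(w) dw` (each `w` is covered by the sliding
windows `[u, u+t]`, `u ∈ [0,s]`, with multiplicity `≤ min(w, t) ≤ w`).  Fubini-free proof: `I := ∫₀K` is
nondecreasing, `∫ᵤ^{u+t}K = I(u+t) − I(u)`, `∫₀ˢ(I(u+t) − I(u))du = ∫ₜ^{s+t}I − ∫₀ˢI`, and by parts
`∫_{(0,s+t]} wK = (s+t)I(s+t) − ∫₀^{s+t}I`; the difference is `[s·I(s+t) − ∫ₜ^{s+t}I] + [t·I(s+t) − ∫ₛ^{s+t}I] ≥ 0`.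
[folklore] -/
theorem stub_windowBudget :
    ∀ K : ℝ → ℝ, Continuous K → (∀ w : ℝ, 0 ≤ K w) →
    ∀ s t : ℝ, 0 ≤ s → 0 ≤ t →
      ∫ u in (0:ℝ)..s, ∫ w in u..(u + t), K w ≤ ∫ w in Set.Ioc (0:ℝ) (s + t), w * K w :=
  -- LANDED (p163077): Theorems/CageBudgetFeketeQuasiSuperadditiveHeatVarianceStubWindowBudget.lean
  _root_.Summit.AtomisticToContinuum.FouriersLaw.Theorems.QuasiSuperadditiveHeatVariance.ReturnFlowBernstein.stub_windowBudget

/-- STUB M — FINITE RUNNING FIRST MOMENT OF THE NEGATIVE MEMORY (the physical half; the route's cage budget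
`K_T = 2∫₀^∞ w·C_T(w)⁻ dw`, TWO-LAYER PLAN node `NegativeMemoryMoment`; verbatim the vetted stub M of line `birth`).
In the crux's arena — `pinnedChain ω₂ lam β γ` (`ω₂, lam, β > 0`), `T > 0`, `μ` a shift- and
momentum-reversal-invariant Gibbs state at `T`, `D` a `μ`-preserving shift-covariant infinite-volume dynamics with
absolutely convergent, continuous `C_T(t) = D.currentCorrelation μ t` — the running first moment of the negative part
of the memory is bounded: `∃ K₀, ∀ R ≥ 0, ∫_{(0,R]} w · max(−C_T(w), 0) dw ≤ K₀` (equivalently `t·C_T⁻ ∈ L¹(0,∞)`).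
`K₀ = 0` wherever `C_T ≥ 0` (harmonic member; kinetic corner, where the limiting memory is completely monotone).
Why it might fail: a negative algebraic tail `−t^(−a)`, `a ≤ 2`, of the SUMMED current memory at some admissible
`T`; no rigorous control of `C_T(t)` for `t > 0` exists for the deterministic anharmonic chain (open since BLR 2000).
[cite: Helfand1960; AokiLukkarinenSpohn2006 (3.25); LukkarinenSpohn2008 Prop 2.4; DeRoeckHuveneers2015 Thm 1 (delimiter)] -/
theorem stub_negativeMemoryMoment :
    ∀ ω₂ lam β γ : ℝ, 0 < ω₂ → 0 < lam → 0 < β → ∀ T : ℝ, 0 < T →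
    ∀ μ : Measure ChainConfig, (pinnedChain ω₂ lam β γ).IsChainGibbsMeasure T μ →
      IsShiftInvariant μ →
      μ.map (fun σ : ChainConfig => fun x : ℤ => ((σ x).1, -(σ x).2)) = μ →
    ∀ D : InfiniteChainDynamics (pinnedChain ω₂ lam β γ), D.PreservesMeasure μ →
      (∀ t : ℝ, ∀ᵐ σ ∂μ, D.flow t (shift σ) = shift (D.flow t σ)) →
      (∀ t : ℝ, D.HasAbsConvergentCorrelation μ t) →
      Continuous (fun t : ℝ => D.currentCorrelation μ t) →
    ∃ K₀ : ℝ, ∀ R : ℝ, 0 ≤ R →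
      ∫ w in Set.Ioc (0:ℝ) R, w * max (-(D.currentCorrelation μ w)) 0 ≤ K₀ := by
  sorry

/-! ### By-name statements of the registered stubs -/

namespace Registered

/-- Statement of registered stub A1 (`stub_windowDomination`), by name. -/
def stub_windowDomination : Prop := type_of% ReturnFlowBernstein.stub_windowDomination

/-- Statement of registered stub A3 (`stub_windowBudget`), by name. -/
def stub_windowBudget : Prop := type_of% ReturnFlowBernstein.stub_windowBudget

/-- Statement of registered stub M (`stub_negativeMemoryMoment`), by name. -/
def stub_negativeMemoryMoment : Prop := type_of% ReturnFlowBernstein.stub_negativeMemoryMoment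

end Registered

/-- **Skeleton theorem (kernel-checked, no `sorry`): the three stubs give the crux
`CageBudgetFekete.QuasiSuperadditiveHeatVariance` BY NAME.**  Cage budget `K := 2·max K₀ 0`: window domination (A1)
with the optimal kernel `C⁻ = max(−C_T, 0)`, window budget (A3) of that kernel, moment bound (M) at `R := s + t`.
[folklore] -/
theorem QuasiSuperadditiveHeatVariance_of (hA : Registered.stub_windowDomination)
    (hB : Registered.stub_windowBudget) (hM : Registered.stub_negativeMemoryMoment) :
    _root_.Summit.AtomisticToContinuum.FouriersLaw.Theses.CageBudgetFekete.QuasiSuperadditiveHeatVariance := by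
  intro ω₂ lam β γ hω hl hβ T hT μ hG hSI hRefl D hPres hShift hAC hC V hV
  obtain ⟨K₀, hK₀⟩ := hM ω₂ lam β γ hω hl hβ T hT μ hG hSI hRefl D hPres hShift hAC hC
  refine ⟨2 * max K₀ 0, by positivity, fun s t hs ht => ?_⟩
  -- the optimal minorant kernel: the negative part of the memory
  have hKc : Continuous fun w : ℝ => max (-(D.currentCorrelation μ w)) 0 := hC.neg.max continuous_const
  have hdom : ∀ w : ℝ, 0 ≤ w →
      -(fun w : ℝ => max (-(D.currentCorrelation μ w)) 0) w ≤ D.currentCorrelation μ w := by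
    intro w _
    have h := le_max_left (-(D.currentCorrelation μ w)) 0
    simp only
    linarith
  have h1 := hA (fun w => D.currentCorrelation μ w) (fun w : ℝ => max (-(D.currentCorrelation μ w)) 0)
    hC hKc hdom V hV s t hs ht
  have h2 := hB (fun w : ℝ => max (-(D.currentCorrelation μ w)) 0) hKc (fun w => le_max_right _ _) s t hs ht
  have h3 := hK₀ (s + t) (add_nonneg hs ht)
  have h4 : K₀ ≤ max K₀ 0 := le_max_left _ _
  linarith

/-- The registered stubs instantiate the skeleton theorem: the crux BY NAME, its only `sorry`s being those of
the open stub M. [folklore] -/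
theorem QuasiSuperadditiveHeatVariance_of_stubs :
    _root_.Summit.AtomisticToContinuum.FouriersLaw.Theses.CageBudgetFekete.QuasiSuperadditiveHeatVariance :=
  QuasiSuperadditiveHeatVariance_of stub_windowDomination stub_windowBudget stub_negativeMemoryMoment

end Summit.AtomisticToContinuum.FouriersLaw.Cruxes.QuasiSuperadditiveHeatVariance.ReturnFlowBernstein
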